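import Mathlib
import HarnessLib
import Summits.Ventures.LatticeQCDFlow.Exactness.NCMCGeneralSpaceReplicaVectorCLT

/-!
# The replica-`t` / jackknife / "independent runs" bar read with a NORMAL quantile under-covers, for EVERY number of replicas: `N(0,1)^{⊗R}{|z_{r₀}| ≤ q √((Σ_{r≠r₀} z_r²)/(R−1))} ≤ N(0,1)([−q, q])`

HONEST FRAMING: exact (Metropolis-corrected) sampling algorithms for lattice gauge theory;
figures of merit are autocorrelation/cost numbers at stated couplings and volumes; no
continuum-physics claim.

Venture `LatticeQCDFlow` (cell pub-lqcd), topic `Exactness`; FANOUT row 13 (`eng-snf`, GEN-24).  NEW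
WORK of the cell against Mathlib (Jensen `ConcaveOn.le_map_integral`,
`AntitoneOn.concaveOn_of_deriv`,
`intervalIntegral.integral_hasDerivAt_right`, `Real.strictConcaveOn_sqrt`, `iIndepFun_pi`,
`Measure.prod_apply_symm`) and the tree's GEN-23 Jg `integral_mul_pi_gaussianReal` (second moments
of the product Gaussian); not a published result (the fact that Student's `t` has heavier tails than
the normal is NAMED ONLY); no definition is introduced.

WHY (row 13).  GEN-23/24 established that the engine's replica-jackknife / `target_means` /
independent-runs / `free_energy ± jackknife` bars over `R ≥ 2` replicas, read with a quantile `q`,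
have ONE limiting coverage, which GEN-24 `NCMCGeneralSpaceReplicaTStatisticStudent` identified as
`L_R(q) = N(0,1)^{⊗R}{z | |z_{r₀}| ≤ q √((Σ_{r ≠ r₀} z_r²)/(R − 1))}` (Student's ratio probability),
and `NCMCGeneralSpaceReplicaTStatisticTwoReplicas` computed `L_2(q) = (2/π)·arctan q`.  This file
proves the qualitative statement valid for EVERY `R ≥ 2` and every `q ≥ 0`, without any density:
that probability is AT MOST the nominal normal coverage `N(0,1)([−q, q])`.  So reading such a bar
with the normal quantile `z_{1−α/2}` can never over-cover asymptotically and (by the `R = 2` value,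
strictly) does under-cover: the calibrating quantile of GEN-23 K5/K6 is never smaller than the
normal one in effect.  The proof is the scale-mixture argument: conditionally on the other
coordinates the event is `{|z_{r₀}| ≤ q w}` with `w = √(s/(R−1))`, of probability `Φ̃(q w)`,
`Φ̃(x) = N(0,1)([−x, x])`; `Φ̃` is CONCAVE on `[0, ∞)` (its derivative `2φ` decreases), so Jensen
gives
`E Φ̃(q W) ≤ Φ̃(q E W)`, and `E W ≤ √(E W²) = 1`.

## Content
* `gaussianPDFReal_zero_one_neg`, `antitoneOn_gaussianPDFReal_zero_one` (§1) — `φ` is even and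
  decreasing on `[0, ∞)`; `gaussianReal_real_Icc_neg_eq_two_mul_integral` — `Φ̃(x) = 2 ∫₀ˣ φ`
  (`x ≥ 0`); `hasDerivAt_integral_gaussianPDFReal`; **`concaveOn_two_mul_integral_gaussianPDFReal`**
  — `x ↦ 2∫₀ˣ φ` is concave on `[0, ∞)`; `gaussianReal_real_Icc_neg_mono`.
* `pi_gaussianReal_measure_abs_eval_le_mul_sqrt_eq_lintegral` (§2) — conditioning on the other
  coordinates (`z_{r₀}` is independent of `W = √((Σ_{r ≠ r₀} z_r²)/(R−1))`):
  `N^{⊗R}{|z_{r₀}| ≤ q W} = ∫ N(0,1)([−qW, qW]) dN^{⊗R}`.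
* `integrable_sq_eval_pi_gaussianReal`, `integral_sqrt_sumSq_erase_div_le_one` (§3) —
  `E √((Σ_{r≠r₀} Z_r²)/(R−1)) ≤ 1` (Jensen for `√`, `E Σ_{r≠r₀} Z_r² = R − 1`).
* **`pi_gaussianReal_measure_abs_eval_le_mul_sqrt_le`** (§3) — `q ≥ 0`, `R ≥ 2`:
  `N(0,1)^{⊗R}{|z_{r₀}| ≤ q √((Σ_{r≠r₀} z_r²)/(R−1))} ≤ N(0,1)([−q, q])`.

NOT CLAIMED: strict inequality (true for `q > 0`; needs strict Jensen and that `W` is not a.s.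
constant — not typed here); the rewrite to GEN-23's `L_R(q)` form (one line with
`pi_gaussianReal_measure_abs_tStat_le_eq_studentRatio`, filed with the coverage corollaries once
that module has an olean); anything numerical.
-/

namespace Summit.Ventures.LatticeQCDFlow.Exactness.GeneralNCMC

open MeasureTheory ProbabilityTheory Set Filter Topology Finset
open scoped ENNReal NNReal Topology

/-! ## §1 The symmetric Gaussian mass `Φ̃(x) = N(0,1)([−x, x])` is concave on `[0, ∞)` -/

section SymmMass

/-- The standard Gaussian density is even. -/
theorem gaussianPDFReal_zero_one_neg (t : ℝ) :
    gaussianPDFReal 0 1 (-t) = gaussianPDFReal 0 1 t := by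
  simp [gaussianPDFReal, sub_zero]

/-- The standard Gaussian density is antitone on `[0, ∞)`. -/
theorem antitoneOn_gaussianPDFReal_zero_one : AntitoneOn (gaussianPDFReal 0 1) (Ici 0) := by
  intro x hx y hy hxy
  simp only [gaussianPDFReal, sub_zero, NNReal.coe_one, mul_one]
  refine mul_le_mul_of_nonneg_left ?_ (by positivity)
  refine Real.exp_le_exp.2 ?_
  have : x ^ 2 ≤ y ^ 2 := by
    have hx' : 0 ≤ x := hx
    nlinarith
  linarith

/-- `Φ̃(x) = N(0,1)([−x, x]) = 2 ∫₀ˣ φ` for `x ≥ 0`. -/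
theorem gaussianReal_real_Icc_neg_eq_two_mul_integral {x : ℝ} (hx : 0 ≤ x) :
    (gaussianReal 0 1).real (Icc (-x) x) = 2 * ∫ t in (0 : ℝ)..x, gaussianPDFReal 0 1 t := by
  have hint : ∀ a b : ℝ, IntervalIntegrable (gaussianPDFReal 0 1) volume a b := fun a b =>
    (integrable_gaussianPDFReal 0 1).intervalIntegrable
  rw [measureReal_def, gaussianReal_apply_eq_integral 0 one_ne_zero,
    ENNReal.toReal_ofReal
      (setIntegral_nonneg measurableSet_Icc fun t _ => gaussianPDFReal_nonneg _ _ _),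
    integral_Icc_eq_integral_Ioc, ← intervalIntegral.integral_of_le (by linarith),
    ← intervalIntegral.integral_add_adjacent_intervals (hint (-x) 0) (hint 0 x)]
  -- `∫_{−x}^0 φ = ∫_0^x φ` by evenness
  have hsym : ∫ t in (-x : ℝ)..0, gaussianPDFReal 0 1 t
      = ∫ t in (0 : ℝ)..x, gaussianPDFReal 0 1 t := by
    have h := intervalIntegral.integral_comp_neg (a := (0 : ℝ)) (b := x)
      (f := gaussianPDFReal 0 1)
    simp only [gaussianPDFReal_zero_one_neg, neg_zero] at h
    rw [← h]
  rw [hsym]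
  ring

/-- `u ↦ ∫₀ᵘ φ` has derivative `φ(u)` everywhere. -/
theorem hasDerivAt_integral_gaussianPDFReal (u : ℝ) :
    HasDerivAt (fun u => ∫ t in (0 : ℝ)..u, gaussianPDFReal 0 1 t) (gaussianPDFReal 0 1 u) u := by
  have hcont : Continuous (gaussianPDFReal 0 1) := by
    unfold gaussianPDFReal
    fun_prop
  exact intervalIntegral.integral_hasDerivAt_right
    ((integrable_gaussianPDFReal 0 1).intervalIntegrable)
    (hcont.stronglyMeasurableAtFilter _ _) hcont.continuousAt

/-- **`x ↦ 2 ∫₀ˣ φ` is CONCAVE on `[0, ∞)`** (its derivative `2φ` is antitone there). -/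
theorem concaveOn_two_mul_integral_gaussianPDFReal :
    ConcaveOn ℝ (Ici (0 : ℝ)) (fun x => 2 * ∫ t in (0 : ℝ)..x, gaussianPDFReal 0 1 t) := by
  have hd : ∀ u, HasDerivAt (fun x => 2 * ∫ t in (0 : ℝ)..x, gaussianPDFReal 0 1 t)
      (2 * gaussianPDFReal 0 1 u) u := fun u => (hasDerivAt_integral_gaussianPDFReal u).const_mul 2
  refine AntitoneOn.concaveOn_of_deriv (convex_Ici 0) ?_ ?_ ?_
  · exact (continuous_iff_continuousAt.2 fun u => (hd u).continuousAt).continuousOn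
  · exact fun u _ => (hd u).differentiableAt.differentiableWithinAt
  · rw [interior_Ici]
    intro x hx y hy hxy
    rw [(hd x).deriv, (hd y).deriv]
    exact mul_le_mul_of_nonneg_left
      (antitoneOn_gaussianPDFReal_zero_one (mem_Ici.2 (le_of_lt hx)) (mem_Ici.2 (le_of_lt hy)) hxy)
      (by norm_num)

/-- `Φ̃` is monotone: `N(0,1)([−a, a]) ≤ N(0,1)([−b, b])` for `a ≤ b`. -/
theorem gaussianReal_real_Icc_neg_mono {a b : ℝ} (hab : a ≤ b) :
    (gaussianReal 0 1).real (Icc (-a) a) ≤ (gaussianReal 0 1).real (Icc (-b) b) :=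
  measureReal_mono (Icc_subset_Icc (by linarith) hab)

end SymmMass

/-! ## §2 Conditioning on the other coordinates -/

section Conditioning

variable {ι : Type*} [Fintype ι] [DecidableEq ι]

/-- For the product Gaussian and ANY coordinate `r₀`: `z_{r₀}` is independent of
`W = √((Σ_{r ≠ r₀} z_r²)/(R−1))`, so `N^{⊗R}{|z_{r₀}| ≤ q W} = ∫ N(0,1)([−qW, qW]) dN^{⊗R}`
(as a `lintegral` of `ENNReal.ofReal`). -/
theorem pi_gaussianReal_measure_abs_eval_le_mul_sqrt_eq_lintegral (r₀ : ι) (q : ℝ) :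
    (Measure.pi fun _ : ι => gaussianReal 0 1) {z : ι → ℝ |
        |z r₀| ≤ q * Real.sqrt ((∑ r ∈ univ.erase r₀, z r ^ 2) / ((Fintype.card ι : ℝ) - 1))}
      = ∫⁻ z, ENNReal.ofReal ((gaussianReal 0 1).real
          (Icc (-(q * Real.sqrt ((∑ r ∈ univ.erase r₀, z r ^ 2) / ((Fintype.card ι : ℝ) - 1))))
            (q * Real.sqrt ((∑ r ∈ univ.erase r₀, z r ^ 2) / ((Fintype.card ι : ℝ) - 1)))))
        ∂(Measure.pi fun _ : ι => gaussianReal 0 1) := by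
  set μ : Measure (ι → ℝ) := Measure.pi fun _ : ι => gaussianReal 0 1 with hμ
  set W : (ι → ℝ) → ℝ := fun z =>
    Real.sqrt ((∑ r ∈ univ.erase r₀, z r ^ 2) / ((Fintype.card ι : ℝ) - 1)) with hW
  have hWm : Measurable W := by
    have hc : ∀ r : ι, Measurable fun z : ι → ℝ => z r := fun r => measurable_pi_apply r
    rw [hW]; fun_prop
  have hXm : Measurable fun z : ι → ℝ => z r₀ := measurable_pi_apply r₀
  -- independence of `z_{r₀}` and `W` (a function of the other coordinates)
  have hind : IndepFun (fun z : ι → ℝ => z r₀) W μ := by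
    set X : ι → ℝ → ℝ := fun j y => if j = r₀ then y else y ^ 2 with hX
    have hXjm : ∀ j, Measurable (X j) := by
      intro j
      by_cases hj : j = r₀
      · simp only [hX, hj, if_true]; exact measurable_id
      · simp only [hX, hj, if_false]; exact measurable_id.pow_const 2
    have hi : iIndepFun (fun j (z : ι → ℝ) => X j (z j)) μ :=
      iIndepFun_pi fun j => (hXjm j).aemeasurable
    have h := hi.indepFun_finsetSum_of_notMem (fun j => (hXjm j).comp (measurable_pi_apply j))
      (Finset.notMem_erase r₀ univ)
    have h1 : (∑ j ∈ univ.erase r₀, fun z : ι → ℝ => X j (z j))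
        = fun z : ι → ℝ => ∑ r ∈ univ.erase r₀, z r ^ 2 := by
      funext z
      rw [Finset.sum_apply]
      refine sum_congr rfl fun j hj => ?_
      simp only [hX, ne_of_mem_erase hj, if_false]
    have h2 : (fun z : ι → ℝ => X r₀ (z r₀)) = fun z : ι → ℝ => z r₀ := by
      funext z; simp only [hX, if_true]
    rw [h1, h2] at h
    -- `W` is a measurable function of the sum
    have h3 : W = (fun s : ℝ => Real.sqrt (s / ((Fintype.card ι : ℝ) - 1)))
        ∘ (fun z : ι → ℝ => ∑ r ∈ univ.erase r₀, z r ^ 2) := by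
      funext z; rfl
    rw [h3]
    exact h.symm.comp measurable_id (by fun_prop)
  -- the joint law is the product of the marginals; integrate out `z_{r₀} ~ N(0,1)` first
  have hA : MeasurableSet {p : ℝ × ℝ | |p.1| ≤ q * p.2} :=
    measurableSet_le measurable_fst.abs (measurable_snd.const_mul q)
  have hjoint : μ.map (fun z => (z r₀, W z)) = (gaussianReal 0 1).prod (μ.map W) := by
    rw [(indepFun_iff_map_prod_eq_prod_map_map hXm.aemeasurable hWm.aemeasurable).1 hind,
      (measurePreserving_eval (fun _ : ι => gaussianReal 0 1) r₀).map_eq]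
  have hset : {z : ι → ℝ | |z r₀| ≤ q * W z}
      = (fun z => (z r₀, W z)) ⁻¹' {p : ℝ × ℝ | |p.1| ≤ q * p.2} := rfl
  rw [hset, ← Measure.map_apply (hXm.prodMk hWm) hA, hjoint, Measure.prod_apply_symm hA,
    lintegral_map _ hWm]
  · refine lintegral_congr fun z => ?_
    have hs : (fun x : ℝ => (x, W z)) ⁻¹' {p : ℝ × ℝ | |p.1| ≤ q * p.2}
        = Icc (-(q * W z)) (q * W z) := by
      ext x; simp [abs_le]
    rw [hs, ofReal_measureReal]
  · -- measurability of `w ↦ N(0,1){x | (x, w) ∈ A}`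
    exact measurable_measure_prodMk_right hA

end Conditioning

/-! ## §3 Jensen: the coverage is at most the normal one -/

section Jensen

variable {ι : Type*} [Fintype ι] [DecidableEq ι] [Nontrivial ι]

omit [DecidableEq ι] [Nontrivial ι] in
/-- `z ↦ z_r²` is integrable under `N(0,1)^{⊗R}`. -/
theorem integrable_sq_eval_pi_gaussianReal (r : ι) :
    Integrable (fun z : ι → ℝ => z r ^ 2) (Measure.pi fun _ : ι => gaussianReal 0 1) := by
  have h := (measurePreserving_eval (fun _ : ι => gaussianReal 0 1) r).integrable_comp
    (g := fun x : ℝ => x ^ 2) (by fun_prop : Measurable fun x : ℝ => x ^ 2).aestronglyMeasurable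
  refine (h.2 ?_)
  have hm := memLp_id_gaussianReal (μ := 0) (v := 1) 2
  exact (memLp_two_iff_integrable_sq hm.1).1 hm

/-- **`E √((Σ_{r ≠ r₀} Z_r²)/(R−1)) ≤ 1`** under `N(0,1)^{⊗R}` (Jensen for the concave square root;
`E Σ_{r≠r₀} Z_r² = R − 1`). -/
theorem integral_sqrt_sumSq_erase_div_le_one (r₀ : ι) :
    ∫ z, Real.sqrt ((∑ r ∈ univ.erase r₀, z r ^ 2) / ((Fintype.card ι : ℝ) - 1))
        ∂(Measure.pi fun _ : ι => gaussianReal 0 1) ≤ 1 := by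
  set μ : Measure (ι → ℝ) := Measure.pi fun _ : ι => gaussianReal 0 1 with hμ
  have hR1 : (0 : ℝ) < (Fintype.card ι : ℝ) - 1 := by
    have h' : (1 : ℝ) < Fintype.card ι := by exact_mod_cast Fintype.one_lt_card (α := ι)
    linarith
  set V : (ι → ℝ) → ℝ := fun z => (∑ r ∈ univ.erase r₀, z r ^ 2) / ((Fintype.card ι : ℝ) - 1)
    with hV
  have hVint : Integrable V μ := by
    rw [hV]
    exact (integrable_finsetSum _ fun r _ => integrable_sq_eval_pi_gaussianReal r).div_const _
  have hVnn : ∀ z, 0 ≤ V z := fun z =>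
    div_nonneg (sum_nonneg fun r _ => sq_nonneg _) hR1.le
  -- `∫ V = 1`
  have h1 : ∀ r, ∫ z, z r ^ 2 ∂μ = 1 := by
    intro r
    have h := integral_mul_pi_gaussianReal (ι := ι) 1 r r
    rw [if_pos rfl, NNReal.coe_one] at h
    rw [← h]
    exact integral_congr_ae (Eventually.of_forall fun z => sq (z r))
  have hVone : ∫ z, V z ∂μ = 1 :=
    calc ∫ z, V z ∂μ = ∫ z, (∑ r ∈ univ.erase r₀, z r ^ 2) / ((Fintype.card ι : ℝ) - 1) ∂μ := rfl
      _ = (∫ z, ∑ r ∈ univ.erase r₀, z r ^ 2 ∂μ) / ((Fintype.card ι : ℝ) - 1) := integral_div _ _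
      _ = (∑ r ∈ univ.erase r₀, ∫ z, z r ^ 2 ∂μ) / ((Fintype.card ι : ℝ) - 1) := by
          rw [integral_finsetSum _ fun r _ => integrable_sq_eval_pi_gaussianReal r]
      _ = (∑ r ∈ univ.erase r₀, (1 : ℝ)) / ((Fintype.card ι : ℝ) - 1) := by
          rw [Finset.sum_congr rfl fun r _ => h1 r]
      _ = 1 := by
          rw [sum_const, Finset.card_erase_of_mem (mem_univ r₀), card_univ, nsmul_eq_mul, mul_one,
            Nat.cast_sub Fintype.card_pos, Nat.cast_one, div_self hR1.ne']
  -- Jensen for the square root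
  have hJ := (Real.strictConcaveOn_sqrt.concaveOn).le_map_integral (μ := μ) (f := V)
    Real.continuous_sqrt.continuousOn isClosed_Ici (Eventually.of_forall fun z => hVnn z) hVint ?_
  · rw [hVone, Real.sqrt_one] at hJ
    exact hJ
  · -- integrability of `√V`: `√v ≤ 1 + v`
    refine Integrable.mono' ((integrable_const (1 : ℝ)).add hVint) ?_ ?_
    · exact (Real.continuous_sqrt.measurable.comp
        hVint.aemeasurable.measurable_mk).aestronglyMeasurable.congr
          (by filter_upwards [hVint.aemeasurable.ae_eq_mk] with z hz; simp [Function.comp, hz])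
    · refine Eventually.of_forall fun z => ?_
      simp only [Function.comp_apply, Pi.add_apply, Real.norm_eq_abs]
      rw [abs_of_nonneg (Real.sqrt_nonneg _)]
      have hv := hVnn z
      nlinarith [Real.sq_sqrt hv, Real.sqrt_nonneg (V z)]

/-- **THE NORMAL QUANTILE NEVER OVER-COVERS**: for every `R ≥ 2`, every coordinate `r₀` and every
`q ≥ 0`, `N(0,1)^{⊗R}{z | |z_{r₀}| ≤ q √((Σ_{r ≠ r₀} z_r²)/(R−1))} ≤ N(0,1)([−q, q])` — the limiting
coverage of the replica-`t` bar (GEN-24 `pi_gaussianReal_measure_abs_tStat_le_eq_studentRatio`) read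
with the normal quantile `q = z_{1−α/2}` is at most `1 − α`. -/
theorem pi_gaussianReal_measure_abs_eval_le_mul_sqrt_le (r₀ : ι) {q : ℝ} (hq : 0 ≤ q) :
    (Measure.pi fun _ : ι => gaussianReal 0 1) {z : ι → ℝ |
        |z r₀| ≤ q * Real.sqrt ((∑ r ∈ univ.erase r₀, z r ^ 2) / ((Fintype.card ι : ℝ) - 1))}
      ≤ (gaussianReal 0 1) (Icc (-q) q) := by
  set μ : Measure (ι → ℝ) := Measure.pi fun _ : ι => gaussianReal 0 1 with hμ
  set W : (ι → ℝ) → ℝ := fun z =>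
    Real.sqrt ((∑ r ∈ univ.erase r₀, z r ^ 2) / ((Fintype.card ι : ℝ) - 1)) with hW
  have hWm : Measurable W := by
    have hc : ∀ r : ι, Measurable fun z : ι → ℝ => z r := fun r => measurable_pi_apply r
    rw [hW]; fun_prop
  have hWnn : ∀ z, 0 ≤ W z := fun z => Real.sqrt_nonneg _
  -- `Φ̃ ∘ (qW)` as a real function, bounded by `1`
  set Φ : ℝ → ℝ := fun x => 2 * ∫ t in (0 : ℝ)..x, gaussianPDFReal 0 1 t with hΦ
  have hΦeq : ∀ x, 0 ≤ x → (gaussianReal 0 1).real (Icc (-x) x) = Φ x := fun x hx =>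
    gaussianReal_real_Icc_neg_eq_two_mul_integral hx
  -- integrability of `W`
  have hR1 : (0 : ℝ) < (Fintype.card ι : ℝ) - 1 := by
    have h' : (1 : ℝ) < Fintype.card ι := by exact_mod_cast Fintype.one_lt_card (α := ι)
    linarith
  have hVint : Integrable (fun z : ι → ℝ =>
      (∑ r ∈ univ.erase r₀, z r ^ 2) / ((Fintype.card ι : ℝ) - 1)) μ :=
    (integrable_finsetSum _ fun r _ => integrable_sq_eval_pi_gaussianReal r).div_const _
  have hWint : Integrable W μ := by
    refine Integrable.mono' ((integrable_const (1 : ℝ)).add hVint) hWm.aestronglyMeasurable ?_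
    refine Eventually.of_forall fun z => ?_
    rw [Real.norm_eq_abs, abs_of_nonneg (hWnn z)]
    simp only [Pi.add_apply]
    have hv : 0 ≤ (∑ r ∈ univ.erase r₀, z r ^ 2) / ((Fintype.card ι : ℝ) - 1) :=
      div_nonneg (sum_nonneg fun r _ => sq_nonneg _) hR1.le
    nlinarith [Real.sq_sqrt hv, Real.sqrt_nonneg ((∑ r ∈ univ.erase r₀, z r ^ 2)
      / ((Fintype.card ι : ℝ) - 1))]
  have hqWint : Integrable (fun z => q * W z) μ := hWint.const_mul q
  -- `Φ` is continuous (differentiable) and bounded by `1` on `[0, ∞)`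
  have hΦcont : Continuous Φ := continuous_iff_continuousAt.2 fun u =>
    ((hasDerivAt_integral_gaussianPDFReal u).const_mul 2).continuousAt
  have hΦle : ∀ x, 0 ≤ x → Φ x ≤ 1 := fun x hx => by
    rw [← hΦeq x hx]; exact measureReal_le_one
  have hΦnn : ∀ x, 0 ≤ x → 0 ≤ Φ x := fun x hx => by
    rw [← hΦeq x hx]; exact measureReal_nonneg
  have hΦWint : Integrable (Φ ∘ fun z => q * W z) μ := by
    refine Integrable.mono' (integrable_const (1 : ℝ))
      ((hΦcont.measurable.comp (hWm.const_mul q)).aestronglyMeasurable) ?_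
    refine Eventually.of_forall fun z => ?_
    have h0 : 0 ≤ q * W z := mul_nonneg hq (hWnn z)
    rw [Function.comp_apply, Real.norm_eq_abs, abs_of_nonneg (hΦnn _ h0)]
    exact hΦle _ h0
  -- (1) conditioning: the measure is `∫ Φ(qW)`
  have h1 : μ {z : ι → ℝ | |z r₀| ≤ q * W z} = ENNReal.ofReal (∫ z, Φ (q * W z) ∂μ) := by
    rw [hμ, hW, pi_gaussianReal_measure_abs_eval_le_mul_sqrt_eq_lintegral r₀ q,
      ← ofReal_integral_eq_lintegral_ofReal]
    · congr 1
      refine integral_congr_ae (Eventually.of_forall fun z => ?_)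
      exact hΦeq _ (mul_nonneg hq (Real.sqrt_nonneg _))
    · refine Integrable.mono' (integrable_const (1 : ℝ)) ?_ (Eventually.of_forall fun z => ?_)
      · have hm : Measurable fun z : ι → ℝ => (gaussianReal 0 1).real
            (Icc (-(q * Real.sqrt ((∑ r ∈ univ.erase r₀, z r ^ 2) / ((Fintype.card ι : ℝ) - 1))))
              (q * Real.sqrt ((∑ r ∈ univ.erase r₀, z r ^ 2) / ((Fintype.card ι : ℝ) - 1)))) := by
          have : (fun z : ι → ℝ => (gaussianReal 0 1).real
            (Icc (-(q * Real.sqrt ((∑ r ∈ univ.erase r₀, z r ^ 2) / ((Fintype.card ι : ℝ) - 1))))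
              (q * Real.sqrt ((∑ r ∈ univ.erase r₀, z r ^ 2) / ((Fintype.card ι : ℝ) - 1)))))
              = Φ ∘ fun z => q * W z := by
            funext z
            exact hΦeq _ (mul_nonneg hq (Real.sqrt_nonneg _))
          rw [this]
          exact hΦcont.measurable.comp (hWm.const_mul q)
        exact hm.aestronglyMeasurable
      · rw [Real.norm_eq_abs, abs_of_nonneg measureReal_nonneg]
        exact measureReal_le_one
    · exact Eventually.of_forall fun z => measureReal_nonneg
  -- (2) Jensen for the concave `Φ` on `[0, ∞)`
  have h2 : ∫ z, Φ (q * W z) ∂μ ≤ Φ (∫ z, q * W z ∂μ) :=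
    concaveOn_two_mul_integral_gaussianPDFReal.le_map_integral hΦcont.continuousOn isClosed_Ici
      (Eventually.of_forall fun z => mem_Ici.2 (mul_nonneg hq (hWnn z))) hqWint hΦWint
  -- (3) `∫ qW = q ∫ W ≤ q`, and `Φ` is monotone
  have h3 : ∫ z, q * W z ∂μ ≤ q := by
    rw [integral_const_mul]
    have := integral_sqrt_sumSq_erase_div_le_one (ι := ι) r₀
    calc q * ∫ z, W z ∂μ ≤ q * 1 := mul_le_mul_of_nonneg_left this hq
      _ = q := mul_one q
  have h0int : 0 ≤ ∫ z, q * W z ∂μ := integral_nonneg fun z => mul_nonneg hq (hWnn z)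
  have h4 : Φ (∫ z, q * W z ∂μ) ≤ Φ q := by
    rw [← hΦeq _ h0int, ← hΦeq _ hq]
    exact gaussianReal_real_Icc_neg_mono h3
  -- assemble
  rw [h1, ← ofReal_measureReal (measure_ne_top _ _), hΦeq q hq]
  exact ENNReal.ofReal_le_ofReal (h2.trans h4)

end Jensen

end Summit.Ventures.LatticeQCDFlow.Exactness.GeneralNCMC
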